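import Summits.Ventures.Crystal3D.Theorems.StickyWulffConstantCoaxialWallLawHexCapCount
import Summits.Ventures.Crystal3D.Theorems.StickyWulffConstantGenericWallFloorExitTwinCap
import HarnessLib

/-!
# The layered (on-site) rung of `stub_coaxialTwoSlabAdhesion`, I: the local contact law on the co-axial site lattice

HONEST FRAMING. Part of the venture `Summits/Ventures/Crystal3D` (cell `crystal3d-full`), helper
`--supports` the crux `CoaxialWallLaw` (stmt-Ventures-19481, `route-Ventures-StickyWulffConstant`),
REGISTERED line `WallLedgerF` (planner cf-p1 gen 16), open stub `stub_coaxialTwoSlabAdhesion`.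
RUNG CREDIT ONLY: this is the first brick of the LAYERED rung (the stub's inequality for every filling
supported on the site lattice of the shared Barlow frame); F-C1 is not moved.

THE SITE LATTICE.  For a Barlow frame `(L, s)` (a linear isometry and an origin) the CO-AXIAL SITE LATTICE is
`L (ℤu₁ + ℤu₂ + ℤw + ℤν) + s` with `u₁ = (1,0,0)`, `u₂ = (½, √3/2, 0)` the layer generators,
`w = (u₁ + u₂)/3` the letter offset and `ν = √(2/3)·e₃` the interlayer vector: the union of the THREE letter
classes `A, B, C` of EVERY basal layer `k·√(2/3)`.  Every Barlow stacking with frame `(L, s)` — in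
particular both grains of a co-axial pair with compatible origins, every coherent twin lamella, every
stacking-fault ribbon, every partial-coset domain between them — is a subset of it.  A filling `X` is
LAYERED (on-site) when `X` is contained in it (hypothesis `hlay` below, inlined: every ball is
`L (i•u₁ + j•u₂ + c•w + k•ν) + s` for integers `i, j, c, k`).

* `twelve_mul_norm_site_sq` — `12 ‖i u₁ + j u₂ + c w + k ν‖² = 3(2i+j+c)² + (3j+c)² + 8k²`.
* `site_unit_layer` — a UNIT site vector changes the layer by `k ∈ {−1, 0, 1}`;
  `site_unit_inPlane_mem_six` — and if `k = 0` it is one of the six in-plane unit vectors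
  `±u₁, ±u₂, ±(u₂ − u₁)`.
* **`layered_card_contacts_add_vacant_le`** — THE LOCAL LAW: in a `1`-separated layered `X`, for every
  ball `z`, `deg z + #{d ∈ SIX(L) : z + d ∉ X} ≤ 12`, where `SIX(L) = {±L u₁, ±L u₂, ±L(u₂ − u₁)}`: the
  contacts of `z` split by layer; those in the layer of `z` sit at the six in-plane sites `z + SIX(L)`;
  those one layer up are unit vectors `u` with `⟪u, L e₃⟫² = 2/3` pairwise at `⟪u, u'⟫ ≤ ½`, hence at most
  THREE (`card_le_three_of_polarCap`, no angles), and likewise one layer down; no contact skips a layer.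
  So EVERY vacant in-plane site of `z` is a missing contact of `z` itself — the multiplicity-free
  exchange rate that the off-site word accounting of line `WallLedgerF` (`…PayerTwin`, 78 ends per payer)
  cannot have.

WHAT THIS IS NOT: not the stub (the count of in-plane run ends and the assembly are the next files
`…LayeredCount`, `…Layered`); nothing about off-site fillings; F-C1 not moved.
-/

noncomputable section

namespace Summit.Ventures.Crystal3D.Theorems

open Summit.Ventures.Crystal3D Finset
open Literature.MathematicalPhysics.StatisticalMechanics (triangularVec₁ triangularVec₂ barlowOffset
  layerNormal twelve_mul_norm_inPlane_sq)
open scoped InnerProductSpace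

/-! ## Site vectors: coordinates and norms -/

/-- The third coordinate of a site vector is `k √(2/3)`. -/
theorem site_apply_two (i j c k : ℤ) :
    ((i : ℝ) • triangularVec₁ (1 : ℝ) + (j : ℝ) • triangularVec₂ (1 : ℝ) + (c : ℝ) • barlowOffset (1 : ℝ) +
      (k : ℝ) • layerNormal (Real.sqrt (2 / 3)) : EuclideanSpace ℝ (Fin 3)) 2 = k * Real.sqrt (2 / 3) :=
  combo_apply_two _ _ _ _ _

/-- `12 ‖i u₁ + j u₂ + c w + k ν‖² = 3(2i+j+c)² + (3j+c)² + 8k²`. -/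
theorem twelve_mul_norm_site_sq (i j c k : ℤ) :
    12 * ‖(i : ℝ) • triangularVec₁ (1 : ℝ) + (j : ℝ) • triangularVec₂ (1 : ℝ) + (c : ℝ) • barlowOffset (1 : ℝ) +
      (k : ℝ) • layerNormal (Real.sqrt (2 / 3))‖ ^ 2 =
      ((3 * (2 * i + j + c) ^ 2 + (3 * j + c) ^ 2 + 8 * k ^ 2 : ℤ) : ℝ) := by
  set q : EuclideanSpace ℝ (Fin 3) := (i : ℝ) • triangularVec₁ (1 : ℝ) + (j : ℝ) • triangularVec₂ (1 : ℝ) +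
    (c : ℝ) • barlowOffset (1 : ℝ) + (k : ℝ) • layerNormal (Real.sqrt (2 / 3)) with hq
  have hsq : ‖q‖ ^ 2 = q 0 ^ 2 + q 1 ^ 2 + q 2 ^ 2 := by
    rw [EuclideanSpace.norm_sq_eq, Fin.sum_univ_three]
    simp only [Real.norm_eq_abs, sq_abs]
  have hq0 : q 0 = i + j / 2 + c / 2 := by
    simp [hq, triangularVec₁, triangularVec₂, barlowOffset, layerNormal]; ring
  have hq1 : q 1 = Real.sqrt 3 / 2 * j + Real.sqrt 3 / 6 * c := by
    simp [hq, triangularVec₁, triangularVec₂, barlowOffset, layerNormal]; ring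
  have hq2 : q 2 = k * Real.sqrt (2 / 3) := by rw [hq]; exact combo_apply_two _ _ _ _ _
  have h3 : Real.sqrt 3 ^ 2 = 3 := Real.sq_sqrt (by norm_num)
  have hH : Real.sqrt (2 / 3) ^ 2 = 2 / 3 := Real.sq_sqrt (by norm_num)
  rw [hsq, hq0, hq1, hq2]
  push_cast
  linear_combination ((3 * (j : ℝ) + c) ^ 2 / 3) * h3 + (12 * (k : ℝ) ^ 2) * hH

/-- **A unit site vector changes the layer by at most one.** -/
theorem site_unit_layer {i j c k : ℤ}
    (h1 : ‖(i : ℝ) • triangularVec₁ (1 : ℝ) + (j : ℝ) • triangularVec₂ (1 : ℝ) + (c : ℝ) • barlowOffset (1 : ℝ) +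
      (k : ℝ) • layerNormal (Real.sqrt (2 / 3))‖ = 1) :
    k = 0 ∨ k = 1 ∨ k = -1 := by
  have h12 := twelve_mul_norm_site_sq i j c k
  rw [h1, one_pow, mul_one] at h12
  have hZ : (3 * (2 * i + j + c) ^ 2 + (3 * j + c) ^ 2 + 8 * k ^ 2 : ℤ) = 12 := by exact_mod_cast h12.symm
  have hk : k ^ 2 ≤ 1 := by nlinarith [sq_nonneg (2 * i + j + c), sq_nonneg (3 * j + c)]
  have hk' : -1 ≤ k ∧ k ≤ 1 := by
    constructor <;> nlinarith [sq_nonneg (k + 1), sq_nonneg (k - 1)]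
  omega

/-- **A unit site vector inside a layer is one of the six in-plane unit vectors** `±u₁, ±u₂, ±(u₂ − u₁)`. -/
theorem site_unit_inPlane_mem_six {i j c : ℤ}
    (h1 : ‖(i : ℝ) • triangularVec₁ (1 : ℝ) + (j : ℝ) • triangularVec₂ (1 : ℝ) + (c : ℝ) • barlowOffset (1 : ℝ) +
      ((0 : ℤ) : ℝ) • layerNormal (Real.sqrt (2 / 3))‖ = 1) :
    (i : ℝ) • triangularVec₁ (1 : ℝ) + (j : ℝ) • triangularVec₂ (1 : ℝ) + (c : ℝ) • barlowOffset (1 : ℝ) +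
      ((0 : ℤ) : ℝ) • layerNormal (Real.sqrt (2 / 3)) ∈
      ({triangularVec₁ 1, -triangularVec₁ 1, triangularVec₂ 1, -triangularVec₂ 1,
        triangularVec₂ 1 - triangularVec₁ 1, -(triangularVec₂ 1 - triangularVec₁ 1)} :
        Finset (EuclideanSpace ℝ (Fin 3))) := by
  have h12 := twelve_mul_norm_site_sq i j c 0
  rw [h1, one_pow, mul_one] at h12
  have hZ : (3 * (2 * i + j + c) ^ 2 + (3 * j + c) ^ 2 + 8 * (0 : ℤ) ^ 2 : ℤ) = 12 := by
    exact_mod_cast h12.symm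
  -- the integer solutions: `A = 2i+j+c`, `B = 3j+c` with `3A² + B² = 12`
  set A : ℤ := 2 * i + j + c with hA
  set B : ℤ := 3 * j + c with hB
  have hE : 3 * A ^ 2 + B ^ 2 = 12 := by rw [hA, hB]; linarith
  have hAb : -2 ≤ A ∧ A ≤ 2 := by
    constructor <;> nlinarith [sq_nonneg B, sq_nonneg (A + 2), sq_nonneg (A - 2)]
  have hBb : -3 ≤ B ∧ B ≤ 3 := by
    constructor <;> nlinarith [sq_nonneg A, sq_nonneg (B + 3), sq_nonneg (B - 3)]
  -- the vector in coordinates: `(A/2, (√3/6) B, 0)`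
  set q : EuclideanSpace ℝ (Fin 3) := (i : ℝ) • triangularVec₁ (1 : ℝ) + (j : ℝ) • triangularVec₂ (1 : ℝ) +
    (c : ℝ) • barlowOffset (1 : ℝ) + ((0 : ℤ) : ℝ) • layerNormal (Real.sqrt (2 / 3)) with hq
  have hq0 : q 0 = (A : ℝ) / 2 := by
    simp [hq, hA, triangularVec₁, triangularVec₂, barlowOffset, layerNormal]; ring
  have hq1 : q 1 = Real.sqrt 3 / 6 * (B : ℝ) := by
    simp [hq, hB, triangularVec₁, triangularVec₂, barlowOffset, layerNormal]; ring
  have hq2 : q 2 = 0 := by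
    simp [hq, triangularVec₁, triangularVec₂, barlowOffset, layerNormal]
  -- coordinates of the six candidates
  have a0 : triangularVec₁ (1 : ℝ) 0 = 1 := by simp [triangularVec₁]
  have a1 : triangularVec₁ (1 : ℝ) 1 = 0 := by simp [triangularVec₁]
  have a2 : triangularVec₁ (1 : ℝ) 2 = 0 := by simp [triangularVec₁]
  have b0 : triangularVec₂ (1 : ℝ) 0 = 1 / 2 := by simp [triangularVec₂]
  have b1 : triangularVec₂ (1 : ℝ) 1 = Real.sqrt 3 / 2 := by simp [triangularVec₂]
  have b2 : triangularVec₂ (1 : ℝ) 2 = 0 := by simp [triangularVec₂]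
  have hext : ∀ v : EuclideanSpace ℝ (Fin 3), q 0 = v 0 → q 1 = v 1 → q 2 = v 2 → q = v := by
    intro v e0 e1 e2
    ext t; fin_cases t
    · exact e0
    · exact e1
    · exact e2
  simp only [mem_insert, mem_singleton]
  obtain ⟨hA1, hA2⟩ := hAb
  obtain ⟨hB1, hB2⟩ := hBb
  interval_cases A <;> interval_cases B <;> norm_num at hE
  · -- A = -2, B = 0 : `-u₁`
    refine Or.inr (Or.inl (hext _ ?_ ?_ ?_))
    · rw [hq0, PiLp.neg_apply, a0]; norm_num
    · rw [hq1, PiLp.neg_apply, a1]; norm_num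
    · rw [hq2, PiLp.neg_apply, a2]; norm_num
  · -- A = -1, B = -3 : `-u₂`
    refine Or.inr (Or.inr (Or.inr (Or.inl (hext _ ?_ ?_ ?_))))
    · rw [hq0, PiLp.neg_apply, b0]; norm_num
    · rw [hq1, PiLp.neg_apply, b1]; ring
    · rw [hq2, PiLp.neg_apply, b2]; norm_num
  · -- A = -1, B = 3 : `u₂ - u₁`
    refine Or.inr (Or.inr (Or.inr (Or.inr (Or.inl (hext _ ?_ ?_ ?_)))))
    · rw [hq0, PiLp.sub_apply, a0, b0]; norm_num
    · rw [hq1, PiLp.sub_apply, a1, b1]; ring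
    · rw [hq2, PiLp.sub_apply, a2, b2]; norm_num
  · -- A = 1, B = -3 : `-(u₂ - u₁)`
    refine Or.inr (Or.inr (Or.inr (Or.inr (Or.inr (hext _ ?_ ?_ ?_)))))
    · rw [hq0, PiLp.neg_apply, PiLp.sub_apply, a0, b0]; norm_num
    · rw [hq1, PiLp.neg_apply, PiLp.sub_apply, a1, b1]; ring
    · rw [hq2, PiLp.neg_apply, PiLp.sub_apply, a2, b2]; norm_num
  · -- A = 1, B = 3 : `u₂`
    refine Or.inr (Or.inr (Or.inl (hext _ ?_ ?_ ?_)))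
    · rw [hq0, b0]; norm_num
    · rw [hq1, b1]; ring
    · rw [hq2, b2]
  · -- A = 2, B = 0 : `u₁`
    refine Or.inl (hext _ ?_ ?_ ?_)
    · rw [hq0, a0]; norm_num
    · rw [hq1, a1]; norm_num
    · rw [hq2, a2]

/-- Differences of sites are site vectors (linearity of the frame). -/
theorem site_sub_site (L : EuclideanSpace ℝ (Fin 3) ≃ₗᵢ[ℝ] EuclideanSpace ℝ (Fin 3)) (s : EuclideanSpace ℝ (Fin 3))
    (i j c k i' j' c' k' : ℤ) :
    (L ((i' : ℝ) • triangularVec₁ (1 : ℝ) + (j' : ℝ) • triangularVec₂ (1 : ℝ) + (c' : ℝ) • barlowOffset (1 : ℝ) +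
        (k' : ℝ) • layerNormal (Real.sqrt (2 / 3))) + s) -
      (L ((i : ℝ) • triangularVec₁ (1 : ℝ) + (j : ℝ) • triangularVec₂ (1 : ℝ) + (c : ℝ) • barlowOffset (1 : ℝ) +
        (k : ℝ) • layerNormal (Real.sqrt (2 / 3))) + s) =
      L (((i' - i : ℤ) : ℝ) • triangularVec₁ (1 : ℝ) + ((j' - j : ℤ) : ℝ) • triangularVec₂ (1 : ℝ) +
        ((c' - c : ℤ) : ℝ) • barlowOffset (1 : ℝ) + ((k' - k : ℤ) : ℝ) • layerNormal (Real.sqrt (2 / 3))) := by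
  rw [add_sub_add_right_eq_sub, ← map_sub]
  congr 1
  push_cast
  module

/-! ## The local law -/

open scoped Classical in
/-- **The local contact law of a layered filling.**  See the module docstring: for `X` `1`-separated
and supported on the site lattice of the frame `(L, s)`, every ball `z ∈ X` satisfies
`deg z + #{d ∈ SIX(L) : z + d ∉ X} ≤ 12`. -/
theorem layered_card_contacts_add_vacant_le
    (L : EuclideanSpace ℝ (Fin 3) ≃ₗᵢ[ℝ] EuclideanSpace ℝ (Fin 3)) (s : EuclideanSpace ℝ (Fin 3))
    (X : Finset (EuclideanSpace ℝ (Fin 3)))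
    (hX : ∀ p ∈ X, ∀ q ∈ X, p ≠ q → 1 ≤ dist p q)
    (hlay : ∀ p ∈ X, ∃ i j c k : ℤ, p = L ((i : ℝ) • triangularVec₁ (1 : ℝ) + (j : ℝ) • triangularVec₂ (1 : ℝ) +
      (c : ℝ) • barlowOffset (1 : ℝ) + (k : ℝ) • layerNormal (Real.sqrt (2 / 3))) + s)
    {z : EuclideanSpace ℝ (Fin 3)} (hz : z ∈ X) :
    (X.filter fun q => dist z q = 1).card +
      (({L (triangularVec₁ 1), -L (triangularVec₁ 1), L (triangularVec₂ 1), -L (triangularVec₂ 1),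
          L (triangularVec₂ 1 - triangularVec₁ 1), -L (triangularVec₂ 1 - triangularVec₁ 1)} :
          Finset (EuclideanSpace ℝ (Fin 3))).filter fun d => z + d ∉ X).card ≤ 12 := by
  set e₃ : EuclideanSpace ℝ (Fin 3) := EuclideanSpace.single (2 : Fin 3) (1 : ℝ) with he₃
  set n : EuclideanSpace ℝ (Fin 3) := L e₃ with hn
  set SIX : Finset (EuclideanSpace ℝ (Fin 3)) := {L (triangularVec₁ 1), -L (triangularVec₁ 1),
    L (triangularVec₂ 1), -L (triangularVec₂ 1), L (triangularVec₂ 1 - triangularVec₁ 1),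
    -L (triangularVec₂ 1 - triangularVec₁ 1)} with hSIX
  set C : Finset (EuclideanSpace ℝ (Fin 3)) := X.filter fun q => dist z q = 1 with hC
  have he₃1 : ‖e₃‖ = 1 := by rw [he₃, PiLp.norm_single, norm_one]
  have hn1 : ‖n‖ = 1 := by rw [hn, LinearIsometryEquiv.norm_map, he₃1]
  obtain ⟨i, j, c, k, hzrep⟩ := hlay z hz
  -- every contact is `z + L(site vector of norm 1)`; record its layer jump
  have hrep : ∀ q ∈ C, ∃ i' j' c' k' : ℤ,
      q - z = L (((i' : ℤ) : ℝ) • triangularVec₁ (1 : ℝ) + ((j' : ℤ) : ℝ) • triangularVec₂ (1 : ℝ) +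
        ((c' : ℤ) : ℝ) • barlowOffset (1 : ℝ) + ((k' : ℤ) : ℝ) • layerNormal (Real.sqrt (2 / 3))) ∧
      ‖((i' : ℤ) : ℝ) • triangularVec₁ (1 : ℝ) + ((j' : ℤ) : ℝ) • triangularVec₂ (1 : ℝ) +
        ((c' : ℤ) : ℝ) • barlowOffset (1 : ℝ) + ((k' : ℤ) : ℝ) • layerNormal (Real.sqrt (2 / 3))‖ = 1 ∧
      ⟪q - z, n⟫_ℝ = k' * Real.sqrt (2 / 3) := by
    intro q hq
    rw [hC, mem_filter] at hq
    obtain ⟨hqX, hqd⟩ := hq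
    obtain ⟨i', j', c', k', hqrep⟩ := hlay q hqX
    refine ⟨i' - i, j' - j, c' - c, k' - k, ?_, ?_, ?_⟩
    · rw [hqrep, hzrep, site_sub_site]
    · have : ‖q - z‖ = 1 := by rw [← dist_eq_norm, dist_comm, hqd]
      rw [hqrep, hzrep, site_sub_site, LinearIsometryEquiv.norm_map] at this
      exact this
    · rw [hqrep, hzrep, site_sub_site, hn, LinearIsometryEquiv.inner_map_map,
        EuclideanSpace.inner_single_right, site_apply_two]
      simp
  -- split by layer
  set C0 := C.filter fun q => ⟪q - z, n⟫_ℝ = 0 with hC0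
  set Cp := C.filter fun q => 0 < ⟪q - z, n⟫_ℝ with hCp
  set Cm := C.filter fun q => ⟪q - z, n⟫_ℝ < 0 with hCm
  have hsplit : C ⊆ C0 ∪ Cp ∪ Cm := by
    intro q hq
    rcases lt_trichotomy 0 ⟪q - z, n⟫_ℝ with h | h | h
    · exact mem_union_left _ (mem_union_right _ (mem_filter.2 ⟨hq, h⟩))
    · exact mem_union_left _ (mem_union_left _ (mem_filter.2 ⟨hq, h.symm⟩))
    · exact mem_union_right _ (mem_filter.2 ⟨hq, h⟩)
  have hcardC : C.card ≤ C0.card + Cp.card + Cm.card :=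
    (card_le_card hsplit).trans ((card_union_le _ _).trans (by
      have := card_union_le C0 Cp; omega))
  -- (1) in-plane contacts sit at the six in-plane sites
  have hC0 : C0.card ≤ (SIX.filter fun d => z + d ∈ X).card := by
    refine card_le_card_of_injOn (fun q => q - z) ?_ ?_
    · intro q hq
      rw [mem_coe, hC0, mem_filter] at hq
      obtain ⟨hqC, hq0⟩ := hq
      obtain ⟨i', j', c', k', hqz, hnorm, hinner⟩ := hrep q hqC
      have hk' : k' = 0 := by
        rw [hinner] at hq0
        have hs : Real.sqrt (2 / 3) ≠ 0 := by positivity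
        exact_mod_cast (mul_eq_zero.1 hq0).resolve_right hs
      subst hk'
      have hsix := site_unit_inPlane_mem_six hnorm
      rw [mem_coe, mem_filter]
      refine ⟨?_, by simp only [add_sub_cancel]; exact (mem_filter.1 hqC).1⟩
      show q - z ∈ SIX
      rw [hqz]
      simp only [mem_insert, mem_singleton] at hsix
      rcases hsix with h | h | h | h | h | h <;> rw [h] <;> simp [hSIX, map_neg]
    · intro q _ q' _ hqq'
      simpa using hqq'
  -- (2) at most three contacts one layer up, (3) one layer down
  have hcap : ∀ (m : EuclideanSpace ℝ (Fin 3)), (m = n ∨ m = -n) →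
      ((C.filter fun q => 0 < ⟪q - z, m⟫_ℝ).card ≤ 3) := by
    intro m hm
    have hm1 : ‖m‖ = 1 := by rcases hm with rfl | rfl; exact hn1; rw [norm_neg, hn1]
    set Cq := C.filter fun q => 0 < ⟪q - z, m⟫_ℝ with hCq
    have hinj : Set.InjOn (fun q => q - z) ↑Cq := by
      intro q _ q' _ hqq'; simpa using hqq'
    rw [← card_image_of_injOn hinj]
    refine card_le_three_of_polarCap hm1 _ ?_ ?_ ?_ ?_
    · intro u hu
      obtain ⟨q, hq, rfl⟩ := mem_image.1 hu
      obtain ⟨-, -, hnorm, -⟩ := hrep q (mem_filter.1 hq).1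
      obtain ⟨i', j', c', k', hqz, hnorm, -⟩ := hrep q (mem_filter.1 hq).1
      rw [hqz, LinearIsometryEquiv.norm_map, hnorm]
    · intro u hu
      obtain ⟨q, hq, rfl⟩ := mem_image.1 hu
      exact (mem_filter.1 hq).2
    · intro u hu
      obtain ⟨q, hq, rfl⟩ := mem_image.1 hu
      obtain ⟨hqC, hpos⟩ := mem_filter.1 hq
      obtain ⟨i', j', c', k', hqz, hnorm, hinner⟩ := hrep q hqC
      have hmn : ⟪q - z, m⟫_ℝ ^ 2 = ⟪q - z, n⟫_ℝ ^ 2 := by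
        rcases hm with rfl | rfl
        · rfl
        · rw [inner_neg_right, neg_sq]
      rw [hmn, hinner]
      have hH : Real.sqrt (2 / 3) ^ 2 = 2 / 3 := Real.sq_sqrt (by norm_num)
      have hk'0 : k' ≠ 0 := by
        rintro rfl
        have : ⟪q - z, m⟫_ℝ = 0 := by
          rcases hm with rfl | rfl
          · rw [hinner]; simp
          · rw [inner_neg_right, hinner]; simp
        rw [this] at hpos; exact lt_irrefl _ hpos
      have hk'1 : (k' : ℝ) ^ 2 = 1 := by
        rcases site_unit_layer hnorm with h | h | h
        · exact absurd h hk'0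
        · rw [h]; norm_num
        · rw [h]; norm_num
      nlinarith [hk'1, hH]
    · intro u hu u' hu' huu'
      obtain ⟨q, hq, rfl⟩ := mem_image.1 hu
      obtain ⟨q', hq', rfl⟩ := mem_image.1 hu'
      have hqC := (mem_filter.1 hq).1
      have hq'C := (mem_filter.1 hq').1
      rw [hC, mem_filter] at hqC hq'C
      have hne : q ≠ q' := fun h => huu' (by rw [h])
      have hd := hX q hqC.1 q' hq'C.1 hne
      have hu1 : ‖q - z‖ = 1 := by rw [← dist_eq_norm, dist_comm, hqC.2]
      have hu1' : ‖q' - z‖ = 1 := by rw [← dist_eq_norm, dist_comm, hq'C.2]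
      have hdd : dist q q' = ‖(q - z) - (q' - z)‖ := by rw [dist_eq_norm]; congr 1; abel
      have hexp : ‖(q - z) - (q' - z)‖ ^ 2 = ‖q - z‖ ^ 2 - 2 * ⟪q - z, q' - z⟫_ℝ + ‖q' - z‖ ^ 2 :=
        norm_sub_sq_real _ _
      rw [hu1, hu1', ← hdd] at hexp
      nlinarith [hexp, hd]
  have hCp : Cp.card ≤ 3 := hcap n (Or.inl rfl)
  have hCm : Cm.card ≤ 3 := by
    have h := hcap (-n) (Or.inr rfl)
    have hEq : Cm = C.filter fun q => 0 < ⟪q - z, -n⟫_ℝ := by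
      rw [hCm]; congr 1; ext q; rw [inner_neg_right]; constructor <;> intro h' <;> linarith
    rw [hEq]; exact h
  -- (4) the six in-plane sites split into occupied and vacant
  have hsix : (SIX.filter fun d => z + d ∈ X).card + (SIX.filter fun d => z + d ∉ X).card ≤ 6 := by
    rw [card_filter_add_card_filter_not]
    rw [hSIX]
    refine (card_insert_le _ _).trans (Nat.succ_le_succ ?_)
    refine (card_insert_le _ _).trans (Nat.succ_le_succ ?_)
    refine (card_insert_le _ _).trans (Nat.succ_le_succ ?_)
    refine (card_insert_le _ _).trans (Nat.succ_le_succ ?_)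
    refine (card_insert_le _ _).trans (Nat.succ_le_succ ?_)
    rw [card_singleton]
  omega

end Summit.Ventures.Crystal3D.Theorems

end
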